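import Summits.ResolutionOfSingularities.ResolutionOfSingularities.Theorems.HilbertSamuelEliminationSigmaMaxModificationsCorridor3SigmaPointCompositionMinLength
import Summits.ResolutionOfSingularities.ResolutionOfSingularities.Theorems.HilbertSamuelEliminationSigmaMaxModificationsCorridor3SigmaMenuSurfacePrep
import Summits.ResolutionOfSingularities.ResolutionOfSingularities.Theorems.HilbertSamuelEliminationSigmaMaxModificationsCorridor3SigmaBoundaryOnSurfaceList
import Literature.AlgebraicGeometry.Resolution.PointCentrePermissible
import HarnessLib

/-!
# [OURS · L1 W4.2] σ-LAYER PHASE B′ — `Corridor3SigmaMenuSurfacePointStep`: THE F-75 POINT STEP = the POINT sub-oracle of the (P1*) prep oracle of record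
# (`SurfacePrep.ofRecord regular phaseS bad cure point`, res-L1-type-o1 CUT 15:00:37Z), as a `SurfacePrep`: «on the regular surface `D` with `M = 0`, blow up
# a FIRST CENTRE OF A SHORTEST composition of point blow-ups resolving the filtered trace configuration `S(E, D) = ⋃_j supp Γ_j` to snc», with its
# «centre regular ∧ ⊆ X(ν)» obligation DISCHARGED (`pointStepOfRecord_regular_subset`, the `hpoint` binder of o1's `SurfacePrep.ofRecord_regular_subset` /
# `surfacePhaseOfRecord_isStratumDisciplined`), «speaks iff `0 < ℓ`», «silent on READY surfaces», and the ℓ-DESCENT at the proposed centre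
# (res-L1-w42-plan-1 RULING v3.14-36 (IC)/(IE), CRUX-PLAN w42 v3.13b (4); crux chain w42 `SigmaMaxModifications` stmt-ResolutionOfSingularities-18506 /
# conjunct `SigmaMaxModificationsCorridor3` stmt-ResolutionOfSingularities-19249; helper of res-L1-w42-stub-1 (gen 5), `--supports stmt-…-19249 --as helper`,
# counted 0)

HONEST FRAMING. OURS design bookkeeping over this seat's ℓ-glue (`…SigmaPointCompositionLength`, `…SigmaPointCompositionMinLength`: `IsShortestFirstCentre`,
`sncLength`, `exists_isShortestFirstCentre`, `IsShortestFirstCentre.sncLength_preimage_lt`), res-L1-type-o1's (P1) tier (`…SigmaMenuSurfacePhase` p540556: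
`SurfacePrep`, `surfaceComponents`; `menuCentre` of `…SigmaMenuDefs`; `…SigmaMenuSurfacePrep` p543457: `SurfacePrep.ofRecord`, `surfacePhaseReady`) and res-type-067's LAYER 1/2 (`…SigmaBoundaryOnSurface(List)` p538136/p540435:
`Boundary.divisorSet`, `Boundary.restrictOff`, `Boundary.SncListOn.divisorSet_isSNC`, `ReadyOfRecord`). NOTHING here is a statement of H. Hironaka's manuscript
[Hironaka2017] nor of [CossartJannsenSaito2020]; no named fact is introduced (F-75 / F-75c enter only through the `0 < ℓ` / `∃ n` premises of the ℓ-glue).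
AI-written; AI review is weaker than expert review.

## Contents (namespace `…Theorems.SigmaMaxModificationsCorridor3.Sigma`)

* `surfaceTraceSet E D : Set (menuCentre D).subscheme` — `S(E, D) := ⋃_j supp Γ_j`, the divisor set of the FILTERED traces `E.restrictOff ι_D` on the reduced
  surface `D̃ := (menuCentre D).subscheme` (`ι_D := (menuCentre D).subschemeι`); `surfaceSncLength E D := sncLength S(E,D) S(E,D)` = **ℓ(E, D)** (centres ON the
  configuration, resolving the configuration; CRUX-PLAN v3.13b (4) `ℓ(D̃, Z)`).
* **`pointStepOfRecord : SurfacePrep`** — `pointStepOfRecord W hW N ν L P E D C :↔ ∃ q : D̃, IsShortestFirstCentre S S q ∧ C = 𝓘(ι_D q)` (the reduced closed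
  point of `W`); `pointStepOfRecord_iff`.
* **`pointStepOfRecord_regular_subset`** — the `hpoint` obligation in o1's binder shape VERBATIM: on a surface component `D` of `X(ν)`, every proposed centre
  has `C.subscheme` regular (`isRegular_subscheme_vanishingIdeal_singleton`) and `supp C = {ι_D q} ⊆ D ⊆ X(ν)`; for ANY `regular`/`bad` readings.
* `exists_pointStepOfRecord_iff_pos` — the point step proposes some centre for `D` iff `0 < ℓ(E, D)`; `surfaceSncLength_eq_zero_of_sncListOn` /
  `surfaceSncLength_eq_zero_of_readyOfRecord` — READY surfaces (067's `ReadyOfRecord`) have `ℓ = 0`, so the point step is silent on them (consistency with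
  `surfaceProposal`'s first branch); `pointStepOfRecord_mem` — the proposed point lies on the configuration `S(E, D)` (so the new exceptional curve lies inside
  the next configuration).
* PLUGGED: `SurfacePrep.ofRecord_regular_subset_pointStep` / **`StrategyE.surfacePhaseReady_pointStep_isStratumDisciplined`** — o1's
  `SurfacePrep.ofRecord_regular_subset` / `surfacePhaseReady_isStratumDisciplined` with `point := pointStepOfRecord` and the `hpoint` binder GONE (only the
  PHASE S and CURE obligations `hS`, `hcure` remain).
* **`pointStepOfRecord_descent`** — at a proposed centre `C = 𝓘(ι_D q)`: for EVERY blow-up `π₁ : D̃′ → D̃` at `q` (any model — by (g1) the strict transform of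
  `D̃` in `Bl_{ι q} W` is one): resolving compositions of `(D̃′, π₁⁻¹ S)` over `π₁⁻¹ S` exist and `sncLength (π₁⁻¹ S) (π₁⁻¹ S) < ℓ(E, D)` — the ℓ-coordinate of
  PHASE B′'s `lex(ℓ, M)` drops (the identification «`π₁⁻¹ S(E, D) = S(E′, D′)`» is the W-side glue (g2), res-type-067/001, not typed here).

VACUITY SELF-CHECK. `pointStepOfRecord` is inhabited exactly when `0 < ℓ(E, D)` (`exists_pointStepOfRecord_iff_pos`), i.e. when the filtered traces on the
regular surface are NOT yet snc AND some resolving composition with centres on the configuration exists (F-75c; with no such composition `ℓ = 0` and the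
step is silent — honest, no step is invented). `pointStepOfRecord_regular_subset` is not vacuous: its conclusion is the regularity of a reduced closed point
and an inclusion `{ι q} ⊆ D`.
-/

noncomputable section

set_option linter.dupNamespace false -- mandated namespace of this single-conjunct summit

open CategoryTheory AlgebraicGeometry TopologicalSpace
open Summit.ResolutionOfSingularities.ResolutionOfSingularities.Theorems.CampaignW42
open Literature.AlgebraicGeometry.Resolution Literature.RingTheory.HilbertSamuel

namespace Summit.ResolutionOfSingularities.ResolutionOfSingularities.Theorems.SigmaMaxModificationsCorridor3.Sigma

universe u

open Scheme.IdealSheafData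

variable {W : Scheme.{u}}

/-! ## The trace configuration and its ℓ -/

/-- [OURS · L1 W4.2] **THE FILTERED TRACE CONFIGURATION `S(E, D) = ⋃_j supp Γ_j`** on the reduced surface `D̃ = (menuCentre D).subscheme`: the divisor set of
the boundary members NOT containing `D`, restricted along `ι_D` (res-type-067's `Boundary.restrictOff` / `Boundary.divisorSet`). NOT a statement of the
manuscript. [folklore] -/
def surfaceTraceSet (E : Boundary W) (D : Closeds W) : Set ↥(menuCentre D).subscheme :=
  (E.restrictOff (menuCentre D).subschemeι).divisorSet

/-- Unfolding (`rfl`). [folklore] -/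
theorem surfaceTraceSet_eq (E : Boundary W) (D : Closeds W) :
    surfaceTraceSet E D = (E.restrictOff (menuCentre D).subschemeι).divisorSet :=
  rfl

/-- [OURS · L1 W4.2] **ℓ(E, D)** — the least number of point blow-ups of `D̃`, with centres on the configuration `S(E, D)`, whose total transform of `S(E, D)`
is a strict normal crossings divisor (`sncLength S S`; `0` if there is none). The ℓ-coordinate of PHASE B′'s `lex(ℓ, M)`. NOT a statement of the manuscript.
[folklore] -/
def surfaceSncLength (E : Boundary W) (D : Closeds W) : ℕ :=
  sncLength (surfaceTraceSet E D) (surfaceTraceSet E D)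

/-- Unfolding (`rfl`). [folklore] -/
theorem surfaceSncLength_eq (E : Boundary W) (D : Closeds W) :
    surfaceSncLength E D = sncLength (surfaceTraceSet E D) (surfaceTraceSet E D) :=
  rfl

/-! ## The point step -/

/-- [OURS · L1 W4.2] **THE F-75 POINT STEP** — the POINT sub-oracle of the (P1*) prep oracle of record (`SurfacePrep.ofRecord … point`): for the surface `D`
at the state `(W, L, P, E)`, propose as centre the REDUCED CLOSED POINT `𝓘(ι_D q)` of `W` for `q ∈ D̃` a FIRST CENTRE OF A SHORTEST composition of point
blow-ups of `D̃` (centres on `S(E, D)`) resolving `S(E, D)` to snc (`IsShortestFirstCentre`). State-blind except through `E` and `D`; no pending datum. NOT a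
statement of the manuscript. [folklore] -/
def pointStepOfRecord : SurfacePrep.{u} :=
  fun W _ _ _ _ _ E D C =>
    ∃ (q : ↥(menuCentre D).subscheme) (hq : IsClosed ({(menuCentre D).subschemeι q} : Set W)),
      IsShortestFirstCentre (surfaceTraceSet E D) (ResolvesToSnc (surfaceTraceSet E D)) q ∧ C = vanishingIdeal ⟨{(menuCentre D).subschemeι q}, hq⟩

variable {hW : IsLocallyNoetherian W} {N : ℕ} {ν : ℕ → ℕ} {L : Labelling W} {P : Option (Pending W)} {E : Boundary W} {D : Closeds W} {C : W.IdealSheafData}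

/-- Unfolding (`Iff.rfl`). [folklore] -/
theorem pointStepOfRecord_iff :
    pointStepOfRecord W hW N ν L P E D C ↔
      ∃ (q : ↥(menuCentre D).subscheme) (hq : IsClosed ({(menuCentre D).subschemeι q} : Set W)),
        IsShortestFirstCentre (surfaceTraceSet E D) (ResolvesToSnc (surfaceTraceSet E D)) q ∧ C = vanishingIdeal ⟨{(menuCentre D).subschemeι q}, hq⟩ :=
  Iff.rfl

/-- A point of the reduced surface maps into `D`. [folklore] -/
theorem subschemeι_mem (D : Closeds W) (q : ↥(menuCentre D).subscheme) : (menuCentre D).subschemeι q ∈ (D : Set W) := by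
  have h : (menuCentre D).subschemeι q ∈ Set.range (menuCentre D).subschemeι := ⟨q, rfl⟩
  rw [Scheme.IdealSheafData.range_subschemeι] at h
  rwa [← coe_support_menuCentre D]

/-- A closed point of the reduced surface is a closed point of `W`. [folklore] -/
theorem isClosed_singleton_subschemeι (D : Closeds W) {q : ↥(menuCentre D).subscheme} (hq : IsClosed ({q} : Set ↥(menuCentre D).subscheme)) :
    IsClosed ({(menuCentre D).subschemeι q} : Set W) := by
  have h := (menuCentre D).subschemeι.isClosedEmbedding.isClosedMap _ hq
  rwa [Set.image_singleton] at h

/-- **THE `hpoint` OBLIGATION, DISCHARGED** (binder shape of res-L1-type-o1's `SurfacePrep.ofRecord_regular_subset` / `surfacePhaseOfRecord_isStratumDisciplined`,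
for ANY regularity reading `regular : SurfaceRegularity` and badness count `bad : SurfaceBadness`): on a surface component `D` of `X(ν)`, every centre the point step proposes is a reduced closed point — a REGULAR
subscheme (`isRegular_subscheme_vanishingIdeal_singleton`) — lying in `D ⊆ X(ν)`. [folklore] -/
theorem pointStepOfRecord_regular_subset (regular : SurfaceRegularity.{u}) (bad : SurfaceBadness.{u}) :
    ∀ (W : Scheme.{u}) (hW : IsLocallyNoetherian W) (L : Labelling W) (P : Option (Pending W)) (E : Boundary W) (D : Closeds W) (C : W.IdealSheafData),
      (D : Set W) ∈ surfaceComponents W N ν → regular W D → bad W E D = 0 → pointStepOfRecord W hW N ν L P E D C →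
        Scheme.IsRegular C.subscheme ∧ (C.support : Set W) ⊆ Scheme.hsStratum W N ν := by
  intro W hW L P E D C hD _ _ h
  obtain ⟨q, hq, -, rfl⟩ := h
  haveI := hW
  refine ⟨isRegular_subscheme_vanishingIdeal_singleton hq, ?_⟩
  rw [Scheme.IdealSheafData.coe_support_vanishingIdeal]
  rintro _ rfl
  exact subset_hsStratum_of_mem_surfaceComponents hD (subschemeι_mem D q)

/-- **The proposed point lies on the configuration** `S(E, D)` (the locus clause of `IsShortestFirstCentre`): so the new exceptional curve lies inside the next
configuration `π₁⁻¹ S`. [folklore] -/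
theorem pointStepOfRecord_mem (h : pointStepOfRecord W hW N ν L P E D C) :
    ∃ (q : ↥(menuCentre D).subscheme) (hq : IsClosed ({(menuCentre D).subschemeι q} : Set W)),
      q ∈ surfaceTraceSet E D ∧ C = vanishingIdeal ⟨{(menuCentre D).subschemeι q}, hq⟩ := by
  obtain ⟨q, hq, hfirst, rfl⟩ := h
  exact ⟨q, hq, hfirst.mem, rfl⟩

/-- **THE POINT STEP SPEAKS IFF `0 < ℓ(E, D)`.** [folklore] -/
theorem exists_pointStepOfRecord_iff_pos :
    (∃ C : W.IdealSheafData, pointStepOfRecord W hW N ν L P E D C) ↔ 0 < surfaceSncLength E D := by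
  constructor
  · rintro ⟨C, q, hq, hfirst, -⟩
    exact hfirst.minLength_pos
  · intro hpos
    obtain ⟨q, hfirst⟩ := exists_isShortestFirstCentre hpos
    exact ⟨_, q, isClosed_singleton_subschemeι D hfirst.isClosed, hfirst, rfl⟩

/-- **SNC TRACES ⇒ `ℓ = 0`**: if the filtered traces already have simple normal crossings on `D̃` (list level, 067's `SncListOn`), no point blow-up is needed —
the empty composition resolves, so `ℓ(E, D) = 0` (no existence premise needed). [folklore] -/
theorem surfaceSncLength_eq_zero_of_sncListOn (h : E.SncListOn (menuCentre D).subschemeι) : surfaceSncLength E D = 0 := by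
  apply Nat.le_zero.mp
  apply minLength_le
  rw [ExistsPointCompositionN.zero_iff, resolvesToSnc_iff]
  exact h.divisorSet_isSNC

/-- **READY ⇒ `ℓ = 0`** (067's readiness of record `ReadyOfRecord` = regular ∧ `SncListOn`): the point step is SILENT on ready surfaces — consistent with
`surfaceProposal`, whose first branch blows a ready surface up and never consults `prep`. [folklore] -/
theorem surfaceSncLength_eq_zero_of_readyOfRecord (h : ReadyOfRecord W E N ν D) : surfaceSncLength E D = 0 :=
  surfaceSncLength_eq_zero_of_sncListOn h.sncListOn

/-- **No point step on a READY surface.** [folklore] -/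
theorem not_pointStepOfRecord_of_readyOfRecord (h : ReadyOfRecord W E N ν D) : ¬ pointStepOfRecord W hW N ν L P E D C := by
  intro hC
  have hpos := exists_pointStepOfRecord_iff_pos.mp ⟨C, hC⟩
  rw [surfaceSncLength_eq_zero_of_readyOfRecord h] at hpos
  exact lt_irrefl 0 hpos

/-- **`ℓ(E, D) = 0` iff the configuration is snc** (set level), given that some resolving composition with centres on it exists (F-75c). [folklore] -/
theorem surfaceSncLength_eq_zero_iff (h : ∃ n, ExistsPointCompositionN (surfaceTraceSet E D) (ResolvesToSnc (surfaceTraceSet E D)) n) :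
    surfaceSncLength E D = 0 ↔ IsStrictNormalCrossingsDivisor (menuCentre D).subscheme (surfaceTraceSet E D) :=
  sncLength_eq_zero_iff h

/-- **THE ℓ-DESCENT AT THE PROPOSED CENTRE.** If the point step proposes `C` for `D`, then `C = 𝓘(ι_D q)` for a point `q ∈ S(E, D)` of the reduced surface such
that for EVERY blow-up `π₁ : D̃′ → D̃` at `q` (any model: by (g1) the strict transform of `D̃` in `Bl_{ι_D q} W` is one) resolving compositions of
`(D̃′, π₁⁻¹ S(E, D))` with centres on `π₁⁻¹ S(E, D)` exist and **`sncLength (π₁⁻¹ S) (π₁⁻¹ S) < ℓ(E, D)`**. [folklore] -/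
theorem pointStepOfRecord_descent (h : pointStepOfRecord W hW N ν L P E D C) :
    ∃ (q : ↥(menuCentre D).subscheme) (hq : IsClosed ({q} : Set ↥(menuCentre D).subscheme))
      (hqW : IsClosed ({(menuCentre D).subschemeι q} : Set W)),
      q ∈ surfaceTraceSet E D ∧ C = vanishingIdeal ⟨{(menuCentre D).subschemeι q}, hqW⟩ ∧
      ∀ ⦃D' : Scheme.{u}⦄ (π₁ : D' ⟶ (menuCentre D).subscheme), IsBlowup π₁ (vanishingIdeal ⟨{q}, hq⟩) →
        (∃ n, ExistsPointCompositionN (π₁ ⁻¹' surfaceTraceSet E D) (ResolvesToSnc (π₁ ⁻¹' surfaceTraceSet E D)) n) ∧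
        sncLength (π₁ ⁻¹' surfaceTraceSet E D) (π₁ ⁻¹' surfaceTraceSet E D) < surfaceSncLength E D := by
  obtain ⟨q, hqW, hfirst, rfl⟩ := h
  exact ⟨q, hfirst.isClosed, hqW, hfirst.mem, rfl, fun D' π₁ hπ₁ => hfirst.sncLength_preimage_lt π₁ hπ₁⟩

/-! ## Plugged into the (P1*) prep oracle / the (P1) tier of record -/

section Plugged

variable {regular : SurfaceRegularity.{u}} {phaseS : SurfacePrep.{u}} {bad : SurfaceBadness.{u}} {cure : SurfacePrep.{u}} {N : ℕ} {ν : ℕ → ℕ}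

/-- **o1's `SurfacePrep.ofRecord_regular_subset` WITH THE POINT STEP PLUGGED**: only the PHASE S and CURE obligations remain. [folklore] -/
theorem SurfacePrep.ofRecord_regular_subset_pointStep
    (hS : ∀ (W : Scheme.{u}) (hW : IsLocallyNoetherian W) (L : Labelling W) (P : Option (Pending W)) (E : Boundary W) (D : Closeds W)
      (C : W.IdealSheafData), (D : Set W) ∈ surfaceComponents W N ν → ¬ regular W D → phaseS W hW N ν L P E D C →
        Scheme.IsRegular C.subscheme ∧ (C.support : Set W) ⊆ Scheme.hsStratum W N ν)
    (hcure : ∀ (W : Scheme.{u}) (hW : IsLocallyNoetherian W) (L : Labelling W) (P : Option (Pending W)) (E : Boundary W) (D : Closeds W)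
      (C : W.IdealSheafData), (D : Set W) ∈ surfaceComponents W N ν → regular W D → 0 < bad W E D → cure W hW N ν L P E D C →
        Scheme.IsRegular C.subscheme ∧ (C.support : Set W) ⊆ Scheme.hsStratum W N ν) :
    ∀ (W : Scheme.{u}) (hW : IsLocallyNoetherian W) (L : Labelling W) (P : Option (Pending W)) (E : Boundary W) (D : Closeds W)
      (C : W.IdealSheafData), (D : Set W) ∈ surfaceComponents W N ν → SurfacePrep.ofRecord regular phaseS bad cure pointStepOfRecord W hW N ν L P E D C →
        Scheme.IsRegular C.subscheme ∧ (C.support : Set W) ⊆ Scheme.hsStratum W N ν :=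
  SurfacePrep.ofRecord_regular_subset hS hcure (pointStepOfRecord_regular_subset regular bad)

/-- **THE (P1) TIER WITH THE READINESS OF RECORD AND THE F-75 POINT STEP IS STRATUM-DISCIPLINED** once PHASE S and the CURE propose regular centres
inside `X(ν)` on their cases (o1's `surfacePhaseReady_isStratumDisciplined`, `hpoint` discharged here, `hReady` by 067's `ReadyOfRecord.isRegular`). [folklore] -/
theorem StrategyE.surfacePhaseReady_pointStep_isStratumDisciplined
    (hS : ∀ (W : Scheme.{u}) (hW : IsLocallyNoetherian W) (L : Labelling W) (P : Option (Pending W)) (E : Boundary W) (D : Closeds W)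
      (C : W.IdealSheafData), (D : Set W) ∈ surfaceComponents W N ν → ¬ regular W D → phaseS W hW N ν L P E D C →
        Scheme.IsRegular C.subscheme ∧ (C.support : Set W) ⊆ Scheme.hsStratum W N ν)
    (hcure : ∀ (W : Scheme.{u}) (hW : IsLocallyNoetherian W) (L : Labelling W) (P : Option (Pending W)) (E : Boundary W) (D : Closeds W)
      (C : W.IdealSheafData), (D : Set W) ∈ surfaceComponents W N ν → regular W D → 0 < bad W E D → cure W hW N ν L P E D C →
        Scheme.IsRegular C.subscheme ∧ (C.support : Set W) ⊆ Scheme.hsStratum W N ν) :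
    (StrategyE.surfacePhaseReady regular phaseS bad cure pointStepOfRecord).IsStratumDisciplined N ν :=
  StrategyE.surfacePhaseReady_isStratumDisciplined hS hcure (pointStepOfRecord_regular_subset regular bad)

/-- The same tier is functional (o1). [folklore] -/
theorem StrategyE.surfacePhaseReady_pointStep_isFunctional (regular : SurfaceRegularity.{u}) (phaseS : SurfacePrep.{u}) (bad : SurfaceBadness.{u})
    (cure : SurfacePrep.{u}) (N : ℕ) (ν : ℕ → ℕ) : (StrategyE.surfacePhaseReady regular phaseS bad cure pointStepOfRecord).IsFunctional N ν :=
  StrategyE.surfacePhaseReady_isFunctional regular phaseS bad cure pointStepOfRecord N ν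

end Plugged

end Summit.ResolutionOfSingularities.ResolutionOfSingularities.Theorems.SigmaMaxModificationsCorridor3.Sigma

end
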